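import Literature.LinearAlgebra.Alternating.DarbouxBasis
import HarnessLib

/-!
# Compatible complex structures on a symplectic vector space: the Siegel space is non-empty

Topic `LinearAlgebra/Alternating`; theorems only (no definition, no named fact, no `sorry`).

[McDuffSalamon2017, §2.5]: for a symplectic vector space `(V, ω)` a linear complex structure `J` (`J² = -1`) is
**compatible with `ω`** if `ω(Jv, Jw) = ω(v, w)` (2.5.2) and `ω(v, Jv) > 0` for `v ≠ 0` (2.5.3); Prop. 2.5.4
(i) ⇔ (ii): `J` is compatible iff `(V, ω)` has a symplectic basis of the form `v₁, …, vₙ, Jv₁, …, Jvₙ`; Lemma 2.5.5: the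
space `𝒥(V, ω)` of compatible complex structures is contractible — in particular NON-EMPTY. Over `ℝ` this space is the
Siegel upper half space `Sp(2n, ℝ)/U(n)` of genus `n` (the complex structures of principally polarized complex tori with a
given Riemann form); the same algebra runs over any linearly ordered field.

We prove the existence half in the form the tree's Hodge-theory files consume (`Motives/WeilTypeComplexStructures`,
`Motives/WeilDatumPeriodDomain`: `J² = -1`, `E(Jx, Jy) = E(x, y)`, `E(x, Jx) > 0`):

* `comp_self_eq_neg_of_symplecticBasis`, `compat_of_symplecticBasis`, `apply_self_J_eq_sum_sq`, `pos_of_symplecticBasis`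
  — for a symplectic (Darboux) basis `(eᵢ, fᵢ)` (`B(eᵢ, eⱼ) = 0 = B(fᵢ, fⱼ)`, `B(eᵢ, fⱼ) = δᵢⱼ`) the operator with
  `J eᵢ = fᵢ`, `J fᵢ = -eᵢ` satisfies `J² = -1`, `B(Jx, Jy) = B(x, y)` and `B(x, Jx) = Σ (coordinates of x)² > 0`
  ([McDuffSalamon2017] Prop. 2.5.4 (ii) ⇒ (i), the standard `J₀` of (2.1)/§2.5);
* **`exists_compatibleComplexStructure`** — every non-degenerate alternating form on a finite-dimensional vector space over
  a linearly ordered field admits a compatible complex structure (Darboux basis from the tree's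
  `exists_symplecticBasis`, [Lang2002] XV §8 Thm. 8.1, then the previous items).

RELATION TO THE TREE. `Literature/Geometry/Symplectic/CompatibleComplexStructure.lean`
(`Geometry.Symplectic.exists_compatible_complexStructure`) proves the same existence for a CONTINUOUS alternating `2`-form
`ω : V [⋀^Fin 2]→L[ℝ] ℝ` on a real INNER PRODUCT space, by McDuff–Salamon's metric construction `J_{g,ω} = (A*A)^{-1/2}A`
(Prop. 2.5.6, spectral theorem), producing a `g`-orthogonal `J`. The present file is the metric-free, purely algebraic
statement for a `LinearMap.BilinForm` over ANY linearly ordered field (no norm, no topology, Darboux basis instead of the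
spectral theorem) — the shape needed on `ℚ`-structures base-changed to `ℝ` (`Submodule ℝ (ℝ ⊗[ℚ] V)` with the real
extension of a rational Riemann form), where no inner product is given. Consumer: `Motives/WeilTypeIIComplexStructures`
(the type-II sub-domain of the period domain of a Weil datum is a Siegel space, hence non-empty).

## References

* [McDuffSalamon2017] D. McDuff, D. Salamon, *Introduction to Symplectic Topology*, 3rd ed. (2017), §2.5: (2.5.2)–(2.5.4),
  Prop. 2.5.4, Lemma 2.5.5.
* [Lang2002] S. Lang, *Algebra*, GTM 211 (2002), Ch. XV §8 Thm. 8.1 (Darboux basis).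
-/

noncomputable section

open Module
open LinearMap (BilinForm)

namespace Literature.LinearAlgebra.Alternating

universe u

variable {K : Type*} [Field K] {V : Type u} [AddCommGroup V] [Module K V] {ι : Type*}

/-! ### The standard complex structure of a symplectic basis -/

section Basis

variable (B : BilinForm K V) (b : Basis (ι ⊕ ι) K V) (J : V →ₗ[K] V)

/-- **`J² = -1`** for the operator `J eᵢ = fᵢ`, `J fᵢ = -eᵢ` of a basis `(eᵢ, fᵢ) = (b (inl i), b (inr i))`.
[cite: McDuffSalamon2017, §2.5 (2.1) and Prop. 2.5.4] -/
theorem comp_self_eq_neg_of_symplecticBasis (hJl : ∀ i, J (b (.inl i)) = b (.inr i))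
    (hJr : ∀ i, J (b (.inr i)) = -b (.inl i)) (x : V) : J (J x) = -x := by
  have h : J ∘ₗ J = -LinearMap.id := b.ext fun s => by
    rcases s with i | i
    · rw [LinearMap.comp_apply, hJl, hJr, LinearMap.neg_apply, LinearMap.id_apply]
    · rw [LinearMap.comp_apply, hJr, map_neg, hJl, LinearMap.neg_apply, LinearMap.id_apply]
  exact LinearMap.congr_fun h x

/-- The Gram entries of `(x, y) ↦ B(x, Jy)` in a symplectic basis: the IDENTITY matrix (`B(eᵢ, Jeⱼ) = B(eᵢ, fⱼ) = δᵢⱼ`,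
`B(fᵢ, Jfⱼ) = -B(fᵢ, eⱼ) = δᵢⱼ`, mixed entries `0`) — i.e. `g_J = ω(·, J·)` is the inner product making the symplectic
basis orthonormal. [cite: McDuffSalamon2017, §2.5 (2.5.4) and Prop. 2.5.4] -/
theorem apply_J_basis_eq_ite [DecidableEq ι] (h11 : ∀ i j, B (b (.inl i)) (b (.inl j)) = 0)
    (h22 : ∀ i j, B (b (.inr i)) (b (.inr j)) = 0)
    (h12 : ∀ i j, B (b (.inl i)) (b (.inr j)) = if i = j then 1 else 0)
    (h21 : ∀ i j, B (b (.inr i)) (b (.inl j)) = if i = j then -1 else 0)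
    (hJl : ∀ i, J (b (.inl i)) = b (.inr i)) (hJr : ∀ i, J (b (.inr i)) = -b (.inl i)) (s t : ι ⊕ ι) :
    B (b s) (J (b t)) = if s = t then 1 else 0 := by
  rcases s with i | i <;> rcases t with j | j
  · rw [hJl, h12]
    simp only [Sum.inl.injEq]
  · rw [hJr, map_neg, h11, neg_zero, if_neg Sum.inl_ne_inr]
  · rw [hJl, h22, if_neg Sum.inr_ne_inl]
  · rw [hJr, map_neg, h21]
    simp only [Sum.inr.injEq]
    split_ifs <;> simp

/-- **First compatibility relation `B(Jx, Jy) = B(x, y)`** for the standard `J` of a SYMPLECTIC basis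
(`B(eᵢ, eⱼ) = 0 = B(fᵢ, fⱼ)`, `B(eᵢ, fⱼ) = δᵢⱼ = -B(fⱼ, eᵢ)`): checked on basis pairs.
[cite: McDuffSalamon2017, §2.5 (2.5.2) and Prop. 2.5.4 (ii) ⇒ (i)] -/
theorem compat_of_symplecticBasis [DecidableEq ι] (h11 : ∀ i j, B (b (.inl i)) (b (.inl j)) = 0)
    (h22 : ∀ i j, B (b (.inr i)) (b (.inr j)) = 0)
    (h12 : ∀ i j, B (b (.inl i)) (b (.inr j)) = if i = j then 1 else 0)
    (h21 : ∀ i j, B (b (.inr i)) (b (.inl j)) = if i = j then -1 else 0)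
    (hJl : ∀ i, J (b (.inl i)) = b (.inr i)) (hJr : ∀ i, J (b (.inr i)) = -b (.inl i)) (x y : V) :
    B (J x) (J y) = B x y := by
  have h : B.compl₁₂ J J = B := LinearMap.BilinForm.ext_basis b fun s t => by
    rw [LinearMap.compl₁₂_apply]
    rcases s with i | i <;> rcases t with j | j
    · rw [hJl, hJl, h22, h11]
    · rw [hJl, hJr, map_neg, h21, h12]
      split_ifs <;> simp
    · rw [hJr, hJl, map_neg, LinearMap.neg_apply, h12, h21]
      split_ifs <;> simp
    · rw [hJr, hJr, map_neg, map_neg, LinearMap.neg_apply, neg_neg, h11, h22]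
  have := LinearMap.congr_fun₂ h x y
  rwa [LinearMap.compl₁₂_apply] at this

variable [Fintype ι] [DecidableEq ι]

/-- **`B(x, Jx) = Σₛ xₛ²`** in the coordinates of the symplectic basis. [cite: McDuffSalamon2017, §2.5 (2.5.3)–(2.5.4) and Prop. 2.5.4] -/
theorem apply_self_J_eq_sum_sq (h11 : ∀ i j, B (b (.inl i)) (b (.inl j)) = 0)
    (h22 : ∀ i j, B (b (.inr i)) (b (.inr j)) = 0)
    (h12 : ∀ i j, B (b (.inl i)) (b (.inr j)) = if i = j then 1 else 0)
    (h21 : ∀ i j, B (b (.inr i)) (b (.inl j)) = if i = j then -1 else 0)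
    (hJl : ∀ i, J (b (.inl i)) = b (.inr i)) (hJr : ∀ i, J (b (.inr i)) = -b (.inl i)) (x : V) :
    B x (J x) = ∑ s, b.repr x s * b.repr x s := by
  have hexp : B x (J x) = ∑ s, ∑ t, b.repr x s * b.repr x t * B (b s) (J (b t)) := by
    conv_lhs => rw [← b.sum_repr x]
    rw [map_sum, LinearMap.sum_apply]
    refine Finset.sum_congr rfl fun s _ => ?_
    rw [map_smul, LinearMap.smul_apply, map_sum, map_sum, smul_eq_mul, Finset.mul_sum]
    refine Finset.sum_congr rfl fun t _ => ?_
    rw [map_smul, map_smul, smul_eq_mul]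
    ring
  rw [hexp]
  refine Finset.sum_congr rfl fun s _ => ?_
  simp_rw [apply_J_basis_eq_ite B b J h11 h22 h12 h21 hJl hJr, mul_ite, mul_one, mul_zero]
  rw [Finset.sum_ite_eq]
  simp

variable [LinearOrder K] [IsStrictOrderedRing K]

/-- **Second compatibility relation `B(x, Jx) > 0` for `x ≠ 0`** (a sum of squares of coordinates, one of them non-zero).
[cite: McDuffSalamon2017, §2.5 (2.5.3) and Prop. 2.5.4 (ii) ⇒ (i)] -/
theorem pos_of_symplecticBasis (h11 : ∀ i j, B (b (.inl i)) (b (.inl j)) = 0)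
    (h22 : ∀ i j, B (b (.inr i)) (b (.inr j)) = 0)
    (h12 : ∀ i j, B (b (.inl i)) (b (.inr j)) = if i = j then 1 else 0)
    (h21 : ∀ i j, B (b (.inr i)) (b (.inl j)) = if i = j then -1 else 0)
    (hJl : ∀ i, J (b (.inl i)) = b (.inr i)) (hJr : ∀ i, J (b (.inr i)) = -b (.inl i)) (x : V) (hx : x ≠ 0) :
    0 < B x (J x) := by
  rw [apply_self_J_eq_sum_sq B b J h11 h22 h12 h21 hJl hJr]
  obtain ⟨s, hs⟩ : ∃ s, b.repr x s ≠ 0 := by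
    by_contra h
    push Not at h
    exact hx (b.repr.injective (Finsupp.ext fun s => by rw [h s, map_zero, Finsupp.zero_apply]))
  exact Finset.sum_pos' (fun t _ => mul_self_nonneg _) ⟨s, Finset.mem_univ _, mul_self_pos.2 hs⟩

end Basis

/-! ### Existence -/

/-- **Compatible complex structures exist** ([McDuffSalamon2017] Prop. 2.5.4 with Lemma 2.5.5: `𝒥(V, ω) ≠ ∅`). A
non-degenerate alternating bilinear form `B` on a finite-dimensional vector space over a linearly ordered field admits
`J` with `J² = -1`, `B(Jx, Jy) = B(x, y)` and `B(x, Jx) > 0` for `x ≠ 0`: take a Darboux basis `(eᵢ, fᵢ)` ([Lang2002]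
XV §8 Thm. 8.1, the tree's `exists_symplecticBasis`) and `J eᵢ = fᵢ`, `J fᵢ = -eᵢ`. Over `ℝ` these `J` form the Siegel
space of `(V, B)`. [cite: McDuffSalamon2017, §2.5 Prop. 2.5.4 and Lemma 2.5.5] [cite: Lang2002, Ch. XV §8 Thm. 8.1] -/
theorem exists_compatibleComplexStructure [LinearOrder K] [IsStrictOrderedRing K] [FiniteDimensional K V]
    {B : BilinForm K V} (hBa : B.IsAlt) (hB : B.Nondegenerate) :
    ∃ J : V →ₗ[K] V, (∀ x, J (J x) = -x) ∧ (∀ x y, B (J x) (J y) = B x y) ∧ ∀ x, x ≠ 0 → 0 < B x (J x) := by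
  classical
  obtain ⟨ι, _, _, b, h11, h22, h12, h21⟩ := exists_symplecticBasis hBa hB
  let J : V →ₗ[K] V := b.constr K (Sum.elim (fun i => b (.inr i)) (fun i => -b (.inl i)))
  have hJl : ∀ i, J (b (.inl i)) = b (.inr i) := fun i => by
    simp only [J, Basis.constr_basis, Sum.elim_inl]
  have hJr : ∀ i, J (b (.inr i)) = -b (.inl i) := fun i => by
    simp only [J, Basis.constr_basis, Sum.elim_inr]
  exact ⟨J, comp_self_eq_neg_of_symplecticBasis b J hJl hJr,
    compat_of_symplecticBasis B b J h11 h22 h12 h21 hJl hJr, pos_of_symplecticBasis B b J h11 h22 h12 h21 hJl hJr⟩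

end Literature.LinearAlgebra.Alternating

end
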